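import Literature.Geometry.Riemannian.MetricFlow
import Literature.Geometry.Riemannian.RiemannianMetricSpace
import Literature.Geometry.Riemannian.HeatKernelGradientPropertyPos
import Literature.Geometry.Riemannian.HeatKernelGradientPropertyZero
import Literature.Geometry.Riemannian.MetricFamilyExtension
import HarnessLib

/-!
# The metric flow of a Ricci flow on a closed manifold (Bamler 2023, §3.7)

R. Bamler, *Compactness theory of the space of super Ricci flows*, Invent. Math. 233 (2023),
§3.7 ("super Ricci flows as metric flows"): a smooth Ricci flow `(M, (g_t)_{t ∈ I})` on a compact
manifold defines a metric flow in the sense of Def. 3.2 — time-slices `(M, d_{g_t})`, conjugate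
heat kernel measures `ν_{x,t;s} = K(x,t;·,s) dg_s` — items (1)–(5), (7) by the standard theory of
the heat kernel and item (6), the gradient property, by Bamler 2020a, Thm. 4.1.

This file ASSEMBLES that metric flow from the tree's bricks, for a `C^∞` family `h` of Riemannian
metrics on a closed connected manifold `M` (modelled on `ℝᵐ`) which is a Ricci flow on an
order-connected time set `S`:

* `ricciFlowMetricFlow hh hR hS hflow : MetricFlow S` — slices `M` with the metric space structure
  of `d_{h(t)}` (`PseudoRiemannianMetric.metricSpace`, complete and separable with the manifold's
  Borel σ-algebra, `RiemannianMetricSpace.lean`); kernels the heat kernel measures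
  `heatKernelMeasure hh hR t x s` (`HeatKernelMeasures.lean`: probability (4), `ν_{x,t;t} = δ_x` (5),
  reproduction formula on Borel sets (7)); gradient property (6) from
  `IsRicciFlow.exists_lipschitz_integral_Phi_comp_eq` (`T > 0`, `HeatKernelGradientPropertyPos.lean`)
  and `IsRicciFlow.integral_heatKernelMeasure_const_or_eq_Phi` (`T = 0`,
  `HeatKernelGradientPropertyZero.lean`), both resting on Bamler 2020a Thm. 4.1
  (`BamlerGradientEstimate.lean`);
* `IsRicciFlow.congr_family` — a family that agrees with a Ricci flow on `S` is a Ricci flow on `S`;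
* `IsRicciFlow.metricFlow` — the metric flow over `[0, T]` of a Ricci flow `(g, cov)` of Riemannian
  metrics given on `M × [0, T]` only (through a smooth Riemannian extension of the family to all
  times, `exists_isContMDiffFamilyOn_extension`).

Connectedness of `M` is needed both for the slices to be metric (finite distances) and for the
`T = 0` dichotomy. Everything is proved; the only definitions are the two metric flows; no named
facts. What is NOT here: the identification of `ν_{x,t;s}` with a smooth positive density
`K(x,t;·,s) dg_s`, `H_n`-concentration (Bamler 2023, Def. 3.30), and the independence of
`IsRicciFlow.metricFlow` from the chosen extension.

## References

* R. H. Bamler, *Compactness theory of the space of super Ricci flows*, Invent. Math. 233 (2023),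
  1121–1277, §3.1 Def. 3.2, §3.7. [Bamler2023]
* R. H. Bamler, *Entropy and heat kernel bounds on a Ricci flow background*, arXiv:2008.07093
  (2020), §2.3, Thm. 4.1. [Bamler2020Entropy]
-/

noncomputable section

open Bundle Set Function Filter Manifold MeasureTheory Measure TopologicalSpace
open scoped Manifold ContDiff Topology ENNReal NNReal

namespace Literature.Geometry.Riemannian

open Lorentzian Lorentzian.PseudoRiemannianMetric MetricFlow

universe u

section Assembly

variable {m : ℕ} {H : Type*} [TopologicalSpace H]
  {I : ModelWithCorners ℝ (EuclideanSpace ℝ (Fin m)) H} [I.Boundaryless]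
  {M : Type u} [TopologicalSpace M] [ChartedSpace H M] [IsManifold I ∞ M]
  [T2Space M] [CompactSpace M] [SecondCountableTopology M] [MeasurableSpace M] [BorelSpace M]
  [ConnectedSpace M]
  {h : ℝ → PseudoRiemannianMetric I ∞ (EuclideanSpace ℝ (Fin m)) (TangentSpace I : M → Type _)}
  (hh : IsContMDiffFamilyOn ∞ h univ) (hR : ∀ r, (h r).IsRiemannian)

/-- **The metric flow of a Ricci flow on a closed connected manifold** (Bamler 2023, §3.7): for a
`C^∞` family `h` of Riemannian metrics on `M` which is a Ricci flow on the order-connected time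
set `S`, the metric flow over `S` with time-slices `(M, d_{h(t)})` and conjugate heat kernels the
heat kernel measures `ν_{x,t;s}`. Items of Def. 3.2: (3) `metricSpace_completeSpace` /
`metricSpace_separableSpace` / `metricSpace_borelSpace`; (4) `isProbabilityMeasure_heatKernelMeasure`;
(5) `heatKernelMeasure_self`; (6) `IsRicciFlow.exists_lipschitz_integral_Phi_comp_eq` (`T > 0`) and
`IsRicciFlow.integral_heatKernelMeasure_const_or_eq_Phi` (`T = 0`); (7)
`heatKernelMeasure_apply_eq_lintegral`. [cite: Bamler2023, §3.7] -/
def ricciFlowMetricFlow {S : Set ℝ} (hS : S.OrdConnected)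
    {cov : ℝ → CovariantDerivative I (EuclideanSpace ℝ (Fin m)) (TangentSpace I : M → Type _)}
    (hflow : IsRicciFlow h cov S) : MetricFlow.{u} S where
  Slice := fun _ ↦ M
  instMetricSpace := fun t ↦ (h t).metricSpace (hR t)
  instCompleteSpace := fun t ↦ metricSpace_completeSpace (hR t)
  instSeparableSpace := fun t ↦ metricSpace_separableSpace (hR t)
  instMeasurableSpace := fun _ ↦ ‹MeasurableSpace M›
  instBorelSpace := fun t ↦ metricSpace_borelSpace (hR t)
  condKernel := fun {t} x s ↦ heatKernelMeasure hh hR t x s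
  isProbabilityMeasure_condKernel := fun {t} x {s} _ ↦ by
    exact isProbabilityMeasure_heatKernelMeasure hh hR t x s
  condKernel_self := fun {t} x ↦ by exact heatKernelMeasure_self hh hR t x
  gradient_property := by
    intro s t hst T hT u hum hu01 hLip
    have hflow' : IsRicciFlow h cov (Icc (s : ℝ) t) := hflow.mono (hS.out s.2 t.2)
    rcases hT.eq_or_lt with hT0 | hTpos
    · -- `T = 0`: the dichotomy for bounded measurable data
      subst hT0
      rcases hflow'.integral_heatKernelMeasure_const_or_eq_Phi hh hR hst hum hu01 with hc | ⟨f', hf', hf'u⟩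
      · exact Or.inl hc
      · refine Or.inr ⟨f', ?_, hf'u⟩
        rw [metricSpace_lipschitzWith_iff]
        intro x y
        simp only [add_zero]
        exact hf' x y
    · -- `T > 0`: Lipschitz data
      obtain ⟨f, hf, rfl⟩ := hLip hTpos
      have hf' := (metricSpace_lipschitzWith_iff (hR s) _ f).1 hf
      have hfc : Continuous f := by
        letI := (h s).metricSpace (hR s)
        exact hf.continuous
      obtain ⟨f', hf'lip, hf'eq⟩ :=
        hflow'.exists_lipschitz_integral_Phi_comp_eq hh hR hst hTpos hfc hf'
      refine Or.inr ⟨f', (metricSpace_lipschitzWith_iff (hR t) _ f').2 hf'lip, fun x ↦ ?_⟩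
      simpa only [Function.comp_apply] using hf'eq x
  reproduction := fun {t₁ t₂ _} h12 h23 x S hS' ↦ by
    exact heatKernelMeasure_apply_eq_lintegral hh hR h12 h23 x hS'

/-- The time-slices of the metric flow of a Ricci flow are the manifold `M`. [cite: Bamler2023, §3.7] -/
@[simp] theorem ricciFlowMetricFlow_Slice {S : Set ℝ} (hS : S.OrdConnected)
    {cov : ℝ → CovariantDerivative I (EuclideanSpace ℝ (Fin m)) (TangentSpace I : M → Type _)}
    (hflow : IsRicciFlow h cov S) (t : S) : (ricciFlowMetricFlow hh hR hS hflow).Slice t = M := rfl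

/-- The conjugate heat kernels of the metric flow of a Ricci flow are the heat kernel measures
`ν_{x,t;s}`. [cite: Bamler2023, §3.7] -/
@[simp] theorem ricciFlowMetricFlow_condKernel {S : Set ℝ} (hS : S.OrdConnected)
    {cov : ℝ → CovariantDerivative I (EuclideanSpace ℝ (Fin m)) (TangentSpace I : M → Type _)}
    (hflow : IsRicciFlow h cov S) {t : S} (x : M) (s : S) :
    (ricciFlowMetricFlow hh hR hS hflow).condKernel (t := t) x s = heatKernelMeasure hh hR t x s :=
  rfl

/-- The distance on the time-`t` slice of the metric flow of a Ricci flow is the Riemannian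
distance of `h(t)`. [cite: Bamler2023, §3.7] -/
theorem ricciFlowMetricFlow_edist {S : Set ℝ} (hS : S.OrdConnected)
    {cov : ℝ → CovariantDerivative I (EuclideanSpace ℝ (Fin m)) (TangentSpace I : M → Type _)}
    (hflow : IsRicciFlow h cov S) (t : S) (x y : M) :
    @edist _ ((ricciFlowMetricFlow hh hR hS hflow).instMetricSpace t).toEDist x y =
      (h t).edist (hR t) x y := rfl

end Assembly

/-! ### A Ricci flow given on `M × [0, T]` only -/

section Interval

variable {m : ℕ} {H : Type*} [TopologicalSpace H]
  {I : ModelWithCorners ℝ (EuclideanSpace ℝ (Fin m)) H} [I.Boundaryless]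
  {M : Type u} [TopologicalSpace M] [ChartedSpace H M] [IsManifold I ∞ M]
  [T2Space M] [CompactSpace M] [SecondCountableTopology M] [MeasurableSpace M] [BorelSpace M]
  {g : ℝ → PseudoRiemannianMetric I ∞ (EuclideanSpace ℝ (Fin m)) (TangentSpace I : M → Type _)}
  {cov : ℝ → CovariantDerivative I (EuclideanSpace ℝ (Fin m)) (TangentSpace I : M → Type _)}

omit [T2Space M] [CompactSpace M] [SecondCountableTopology M] [MeasurableSpace M] [BorelSpace M]
  [I.Boundaryless] in
/-- **A family agreeing with a Ricci flow on `S` is a Ricci flow on `S`** (the flow structure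
only sees the metrics at times in `S`: smoothness on `M × S`, the Levi-Civita property, and the
one-sided time derivatives within `S`). [folklore] -/
theorem IsRicciFlow.congr_family {S : Set ℝ} (hflow : IsRicciFlow g cov S)
    {h : ℝ → PseudoRiemannianMetric I ∞ (EuclideanSpace ℝ (Fin m)) (TangentSpace I : M → Type _)}
    (hh : IsContMDiffFamilyOn ∞ h S) (heq : ∀ s ∈ S, h s = g s) : IsRicciFlow h cov S where
  smooth := hh
  isLeviCivita t ht := by rw [heq t ht]; exact hflow.isLeviCivita t ht
  hasDerivWithinAt t ht x X Y := by
    refine (hflow.hasDerivWithinAt t ht x X Y).congr (fun s hs ↦ ?_) ?_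
    · rw [heq s hs]
    · rw [heq t ht]

/-- **The metric flow over `[0, T]` of a Ricci flow of Riemannian metrics on a closed connected
manifold given on `M × [0, T]`** (Bamler 2023, §3.7): extend the family smoothly to a family of
Riemannian metrics for all times (`exists_isContMDiffFamilyOn_extension`) and take
`ricciFlowMetricFlow`; for `0 ≤ s ≤ t ≤ T` the kernels are the heat kernel measures of the heat
equation of `g` on `M × [s, t]`. [cite: Bamler2023, §3.7] -/
def IsRicciFlow.metricFlow [ConnectedSpace M] {T : ℝ} (hT : 0 < T)
    (hflow : IsRicciFlow g cov (Icc 0 T)) (hR : ∀ s ∈ Icc 0 T, (g s).IsRiemannian) :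
    MetricFlow.{u} (Icc 0 T) :=
  let ext := exists_isContMDiffFamilyOn_extension hT hflow.smooth hR
  ricciFlowMetricFlow ext.choose_spec.1 ext.choose_spec.2.1 ordConnected_Icc
    (hflow.congr_family (ext.choose_spec.1.mono (subset_univ _)) ext.choose_spec.2.2)

/-- The time-slices of `IsRicciFlow.metricFlow` are the manifold `M`. [cite: Bamler2023, §3.7] -/
@[simp] theorem IsRicciFlow.metricFlow_Slice [ConnectedSpace M] {T : ℝ} (hT : 0 < T)
    (hflow : IsRicciFlow g cov (Icc 0 T)) (hR : ∀ s ∈ Icc 0 T, (g s).IsRiemannian)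
    (t : Icc (0 : ℝ) T) : (hflow.metricFlow hT hR).Slice t = M := rfl

end Interval

end Literature.Geometry.Riemannian
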